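import Mathlib.RingTheory.Henselian
import Mathlib.Algebra.CubicDiscriminant
import Mathlib.Topology.Algebra.Valued.ValuedField
import Mathlib.Algebra.Polynomial.Derivative
import HarnessLib

/-!
# F0 · P3c · line LH6 «StCharTS» — «DOMINANT-ROOT★»: a monic cubic with a dominant trace coefficient has a SIMPLE root of the dominant size
# (Newton polygon ∕ Hensel's lemma) [Neukirch1999 Ch. II (4.6), (6.3)–(6.4)]

Cell `pub/hodgecm-mathlib`, crux H413 = `stmt-HodgeConjecture-24833` (`--supports` lane, helper), route HCCMUnconditional; seat F0P3a-p05 (g19).  Dealt as «DOMINANT-ROOT★» by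
F0P3b-plan (g23) 05:54:45Z (the generic valued-field lemma under «HYP-SET★» (H3) and «ELL-CRIT★» (E2)).  THEOREMS ONLY; Mathlib-only imports.

* §1 (any Henselian local ring `R`): `isUnit_one_add_of_mem_maximalIdeal`; **`exists_isRoot_cubic_near_one`** — for `ε, δ ∈ 𝔪_R` the cubic `g = X³ − X² + εX + δ` (reduction `X²(X − 1)`) has a root
  `z ≡ 1 (mod 𝔪)` at which `g′(z)` is a UNIT (Hensel at the simple residual root `1`).
* §2 (a valued field `K` whose valuation ring `𝒪[K]` is Henselian — e.g. every complete discretely valued field, `inferInstanceAs (HenselianLocalRing (w.adicCompletionIntegers L))`):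
  **`exists_isRoot_v_eq_of_dominant`** — a monic cubic `p = X³ + c₂X² + c₁X + c₀` with `|c₁| < |c₂|²` and `|c₀| < |c₂|³` has a root `α ∈ K` with `|α| = |c₂|` and `p′(α) ≠ 0`
  (rescale `X = −c₂·Z`, apply §1 to `Z³ − Z² + (c₁∕c₂²)Z − c₀∕c₂³`).  For the characteristic polynomial of a unitary `γ` with `|tr γ| > 1` (`|c₁| = |c₂| = |tr γ|`, `|c₀| = 1`,
  ★ `F0P3cStCharTSHyperbolicCore`) this is the dominant eigenvalue `α`, `|α| = |tr γ|`.
HONEST LABEL: count-neutral (TOR)-road brick; HC_CM is proved only modulo the 7 printed citations (2 remaining: hLiu418 = stmt-HodgeConjecture-24832, h413 =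
stmt-HodgeConjecture-24833) until rung 0 closes.

## References
* [Neukirch1999] J. Neukirch, *Algebraic Number Theory*, Grundlehren 322 (1999), Ch. II (4.6) Hensel's Lemma p. 129, (6.3)–(6.4) Newton polygon pp. 144–145.
* [Cassels1986] J. W. S. Cassels, *Local Fields* (1986), Ch. 4 Lemma 3.1 (Hensel).
* [Rogawski1990] J. D. Rogawski, *Automorphic Representations of Unitary Groups in Three Variables*, Ann. of Math. Stud. 123 (1990), §12.5 p. 182 (hyperbolic regular elements).
-/

set_option autoImplicit false
-- the mandated namespace has the single-problem summit's repeated segment (`HodgeConjecture.HodgeConjecture`)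
set_option linter.dupNamespace false

noncomputable section

open Polynomial

namespace Summit.HodgeConjecture.HodgeConjecture.Cruxes.H413.F0P3cStCharTSDominantRoot

/-! ## §1 Hensel at the simple residual root `1` of `Z²(Z − 1)` -/

section Henselian

variable {R : Type*} [CommRing R] [HenselianLocalRing R]

/-- In a local ring, `1 + m` is a unit for `m ∈ 𝔪`. [folklore] -/
theorem isUnit_one_add_of_mem_maximalIdeal {m : R} (hm : m ∈ IsLocalRing.maximalIdeal R) : IsUnit (1 + m) := by
  by_contra h
  have h1 : (1 : R) ∈ IsLocalRing.maximalIdeal R := by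
    have h' := Ideal.sub_mem _ ((IsLocalRing.mem_maximalIdeal _).2 h) hm
    rwa [add_sub_cancel_right] at h'
  exact (IsLocalRing.maximalIdeal.isMaximal R).ne_top (Ideal.eq_top_of_isUnit_mem _ h1 isUnit_one)

/-- A unit plus an element of `𝔪` is a unit. [folklore] -/
theorem isUnit_add_of_isUnit_of_mem_maximalIdeal {u m : R} (hu : IsUnit u) (hm : m ∈ IsLocalRing.maximalIdeal R) : IsUnit (u + m) := by
  obtain ⟨u, rfl⟩ := hu
  have h : (u : R) + m = u * (1 + ↑u⁻¹ * m) := by rw [mul_add, mul_one, ← mul_assoc, Units.mul_inv, one_mul]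
  rw [h]
  exact (Units.isUnit u).mul (isUnit_one_add_of_mem_maximalIdeal (Ideal.mul_mem_left _ _ hm))

/-- **HENSEL AT THE RESIDUAL ROOT `1` OF `Z²(Z − 1)`**: for `ε, δ ∈ 𝔪_R` (`R` Henselian local) the cubic `g = Z³ − Z² + εZ + δ` has a root `z` with `z − 1 ∈ 𝔪_R`, and
`g′(z) = 3z² − 2z + ε` is a UNIT (`g(1) = ε + δ ∈ 𝔪`, `g′(1) = 1 + ε ∈ R^×`, `g′(z) − g′(1) = (z − 1)(3z + 1) ∈ 𝔪`). [cite: Neukirch1999, Ch. II (4.6) p. 129] [cite: Cassels1986, Ch. 4 Lemma 3.1] -/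
theorem exists_root_cubic_near_one {ε δ : R} (hε : ε ∈ IsLocalRing.maximalIdeal R) (hδ : δ ∈ IsLocalRing.maximalIdeal R) :
    ∃ z : R, z ^ 3 - z ^ 2 + ε * z + δ = 0 ∧ z - 1 ∈ IsLocalRing.maximalIdeal R ∧ IsUnit (3 * z ^ 2 - 2 * z + ε) := by
  set g : R[X] := X ^ 3 - X ^ 2 + C ε * X + C δ with hg
  have hcubic : Cubic.toPoly ⟨1, -1, ε, δ⟩ = g := by
    simp only [Cubic.toPoly, hg, map_one, one_mul, map_neg, neg_mul, sub_eq_add_neg]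
  have hmonic : g.Monic := hcubic ▸ Cubic.monic_of_a_eq_one rfl
  have heval : ∀ z : R, g.eval z = z ^ 3 - z ^ 2 + ε * z + δ := fun z => by
    simp only [hg, eval_add, eval_sub, eval_pow, eval_X, eval_mul, eval_C]
  have hder : ∀ z : R, (derivative g).eval z = 3 * z ^ 2 - 2 * z + ε := fun z => by
    simp only [hg, derivative_add, derivative_sub, derivative_X_pow, derivative_mul, derivative_C, derivative_X, zero_mul, zero_add, mul_one, add_zero,
      eval_add, eval_sub, eval_mul, eval_pow, eval_X, eval_C, Nat.cast_ofNat]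
    ring
  have h1 : g.eval 1 ∈ IsLocalRing.maximalIdeal R := by
    rw [heval, one_pow, one_pow, sub_self, zero_add, mul_one]
    exact add_mem hε hδ
  have h2 : IsUnit ((derivative g).eval 1) := by
    rw [hder]
    have e : (3 : R) * 1 ^ 2 - 2 * 1 + ε = 1 + ε := by ring
    rw [e]
    exact isUnit_one_add_of_mem_maximalIdeal hε
  obtain ⟨z, hz, hz1⟩ := HenselianLocalRing.is_henselian g hmonic 1 h1 h2
  refine ⟨z, by rw [← heval]; exact hz, hz1, ?_⟩
  have hdiff : 3 * z ^ 2 - 2 * z + ε = (1 + ε) + (z - 1) * (3 * z + 1) := by ring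
  rw [hdiff]
  exact isUnit_add_of_isUnit_of_mem_maximalIdeal (isUnit_one_add_of_mem_maximalIdeal hε) (Ideal.mul_mem_right _ _ hz1)

end Henselian

/-! ## §2 The dominant root of a cubic over a Henselian valued field -/

section ValuedField

open scoped Valued

variable {K : Type*} [Field K] [Valued K (WithZero (Multiplicative ℤ))]

/-- `x ∈ 𝒪[K]` lies in the maximal ideal iff `|x| < 1`. [folklore] -/
theorem mem_maximalIdeal_integer_iff (x : 𝒪[K]) : x ∈ IsLocalRing.maximalIdeal 𝒪[K] ↔ Valued.v (x : K) < 1 := by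
  have hint : (Valued.v (R := K)).Integers 𝒪[K] := Valuation.integer.integers _
  rw [IsLocalRing.mem_maximalIdeal, mem_nonunits_iff, hint.isUnit_iff_valuation_eq_one]
  exact ⟨fun h => lt_of_le_of_ne x.2 h, fun h => ne_of_lt h⟩

/-- **«DOMINANT-ROOT★»: A MONIC CUBIC WITH A DOMINANT `X²`-COEFFICIENT HAS A SIMPLE ROOT OF THE DOMINANT SIZE.**  Let `K` be a valued field whose valuation ring `𝒪[K]` is
Henselian (every complete discretely valued field; for `K = L_w`: `inferInstanceAs (HenselianLocalRing (w.adicCompletionIntegers L))`), and `p = X³ + c₂X² + c₁X + c₀ ∈ K[X]`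
monic with `|c₁| < |c₂|²` and `|c₀| < |c₂|³` (Newton polygon with an isolated first slope; the UNITARY HYPERBOLIC case has `|c₁| = |c₂| > 1 = |c₀|`).  Then there is `α ∈ K` with
`p(α) = 0`, `|α| = |c₂|` and `p′(α) ≠ 0` — rescale `X = −c₂Z` and lift the simple residual root `Z = 1` of `Z²(Z − 1)` (§1).
[cite: Neukirch1999, Ch. II (4.6) p. 129, (6.3)–(6.4) pp. 144–145] [cite: Rogawski1990, §12.5 p. 182] -/
theorem exists_isRoot_v_eq_of_dominant [HenselianLocalRing 𝒪[K]] (p : K[X]) (hp : p.Monic) (hdeg : p.natDegree = 3)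
    (h1 : Valued.v (p.coeff 1) < Valued.v (p.coeff 2) ^ 2) (h0 : Valued.v (p.coeff 0) < Valued.v (p.coeff 2) ^ 3) :
    ∃ α : K, p.IsRoot α ∧ Valued.v α = Valued.v (p.coeff 2) ∧ (derivative p).eval α ≠ 0 := by
  have hc₂ : p.coeff 2 ≠ 0 := by
    intro h; rw [h, map_zero, zero_pow two_ne_zero] at h1; exact not_lt_zero h1
  set a : K := -p.coeff 2 with ha_def
  have ha : a ≠ 0 := neg_ne_zero.2 hc₂
  have hva : Valued.v a = Valued.v (p.coeff 2) := Valuation.map_neg _ _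
  have hva0 : Valued.v a ≠ 0 := (Valuation.ne_zero_iff _).2 ha
  -- the expansions of `p` and `p′`
  have hc3 : p.coeff 3 = 1 := by rw [← hdeg]; exact hp.coeff_natDegree
  have hpX : ∀ x : K, p.eval x = x ^ 3 + p.coeff 2 * x ^ 2 + p.coeff 1 * x + p.coeff 0 := fun x => by
    rw [Polynomial.eval_eq_sum_range, hdeg]
    simp only [Finset.sum_range_succ, Finset.sum_range_zero, zero_add, pow_zero, mul_one, pow_one, hc3, one_mul]
    ring
  have hpdX : ∀ x : K, (derivative p).eval x = 3 * x ^ 2 + 2 * p.coeff 2 * x + p.coeff 1 := fun x => by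
    have hlt : (derivative p).natDegree < 3 := lt_of_le_of_lt (natDegree_derivative_le p) (by rw [hdeg]; norm_num)
    rw [Polynomial.eval_eq_sum_range' hlt]
    simp only [Finset.sum_range_succ, Finset.sum_range_zero, zero_add, coeff_derivative, hc3, pow_zero, mul_one, pow_one, Nat.cast_zero, Nat.cast_one,
      Nat.cast_ofNat, one_mul]
    ring
  -- the rescaled coefficients `ε = c₁ ∕ a²`, `δ = c₀ ∕ a³` lie in `𝔪`
  have hε : Valued.v (p.coeff 1 / a ^ 2) < 1 := by
    rw [map_div₀, map_pow, hva]
    exact (div_lt_one₀ (pow_pos (zero_lt_iff.2 ((Valuation.ne_zero_iff _).2 hc₂)) 2)).2 h1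
  have hδ : Valued.v (p.coeff 0 / a ^ 3) < 1 := by
    rw [map_div₀, map_pow, hva]
    exact (div_lt_one₀ (pow_pos (zero_lt_iff.2 ((Valuation.ne_zero_iff _).2 hc₂)) 3)).2 h0
  set εO : 𝒪[K] := ⟨p.coeff 1 / a ^ 2, (Valuation.mem_integer_iff _ _).2 hε.le⟩ with hεO
  set δO : 𝒪[K] := ⟨p.coeff 0 / a ^ 3, (Valuation.mem_integer_iff _ _).2 hδ.le⟩ with hδO
  obtain ⟨z, hz, hz1, hzu⟩ := exists_root_cubic_near_one ((mem_maximalIdeal_integer_iff εO).2 hε) ((mem_maximalIdeal_integer_iff δO).2 hδ)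
  -- `|z| = 1`
  have hz1' : Valued.v (((z - 1 : 𝒪[K])) : K) < 1 := (mem_maximalIdeal_integer_iff _).1 hz1
  have hvz : Valued.v (z : K) = 1 := by
    have e : (z : K) = 1 + (((z - 1 : 𝒪[K])) : K) := by push_cast; ring
    rw [e]
    exact Valuation.map_one_add_of_lt _ hz1'
  -- the root `α = a z`
  refine ⟨a * (z : K), ?_, ?_, ?_⟩
  · -- `p(a z) = a³ · g(z) = 0`
    have hzK : (z : K) ^ 3 - (z : K) ^ 2 + p.coeff 1 / a ^ 2 * (z : K) + p.coeff 0 / a ^ 3 = 0 := by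
      have h := congrArg (fun t : 𝒪[K] => (t : K)) hz
      simpa [hεO, hδO] using h
    rw [IsRoot, hpX]
    have e : (a * (z : K)) ^ 3 + p.coeff 2 * (a * (z : K)) ^ 2 + p.coeff 1 * (a * (z : K)) + p.coeff 0 =
        a ^ 3 * ((z : K) ^ 3 - (z : K) ^ 2 + p.coeff 1 / a ^ 2 * (z : K) + p.coeff 0 / a ^ 3) := by
      rw [ha_def]; field_simp; ring
    rw [e, hzK, mul_zero]
  · rw [map_mul, hvz, mul_one, hva]
  · -- `p′(a z) = a² · g′(z) ≠ 0`
    rw [hpdX]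
    have e : 3 * (a * (z : K)) ^ 2 + 2 * p.coeff 2 * (a * (z : K)) + p.coeff 1 = a ^ 2 * (3 * (z : K) ^ 2 - 2 * (z : K) + p.coeff 1 / a ^ 2) := by
      rw [ha_def]; field_simp; ring
    rw [e]
    refine mul_ne_zero (pow_ne_zero 2 ha) ?_
    have hu : IsUnit (3 * (z : K) ^ 2 - 2 * (z : K) + p.coeff 1 / a ^ 2) := by
      have h := hzu.map (𝒪[K]).subtype
      simp only [map_add, map_sub, map_mul, map_pow, map_ofNat] at h
      simpa [hεO] using h
    exact hu.ne_zero

end ValuedField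

end Summit.HodgeConjecture.HodgeConjecture.Cruxes.H413.F0P3cStCharTSDominantRoot

end
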